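import Literature.Computability.MetaComplexity.BoundedArithUnivSkolem
import HarnessLib

/-!
# The engine: length induction for open formulas, iteration of Skolem symbols

Topic `Literature/Computability/MetaComplexity` (continuation of `BoundedArithUnivSkolem.lean`).
In a Herbrand-saturated model `K` of `QSym.univTheory k` we prove the two combinatorial engines
of the Herbrand route to Buss's conservation theorem:

* `QSym.openLIND` — **length induction for open formulas** with parameters: if `π(p̄, 0)` and
  `π(p̄, j) → π(p̄, j+1)` for all `j < |b|` then `π(p̄, |b|)`; from the least-zero symbol of
  the characteristic symbol of `π` (facts of `BoundedArithUnivTheory`) and the predecessor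
  `x ∸ 1` — no induction *in `K`* is used beyond these universal facts;
* `QSym.exists_skolem_sym_ctx` — Skolem symbols for `∀ j u ∃ u' Θ(p̄, j, u, u')` with `Θ` an
  open formula in context variables and `p̄` parameters (the instantiation `QSym.instCtx`);
* `QSym.exists_iterate` — **iteration**: given such a step `Θ` (total in `u'`), a start `u₀`, a
  length `|b|` and a value bound `R`, there are parameters `c̄` and an iterate symbol `It` with
  `It(c̄, u₀, 0) = u₀` and, for `j < |b|`, some `y` with `Θ(p̄, j, It(c̄,u₀,j), y)` and
  `y ≤ R → It(c̄, u₀, j+1) = y` (limited iteration of the Skolem symbol, Buss 1990, Thm. 11(b));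
* `QSym.exists_collect` — **collection**: the same iterates (start `0`) are the digits of one
  code `W ≤ 2 S' + 1` under the decoder `seqel` with parameters `(2b+1) # (2R+1)`, `|R|` — a
  decoder independent of the Skolem data (used for strict `Σᵇ` forms).

## References

* S. R. Buss, *Axiomatizations and conservation results for fragments of bounded arithmetic*,
  Contemp. Math. 106, AMS 1990, Thm. 11(b) (limited iteration) and §4, Prop. 16 (the rôle of
  `Σᵇᵢ₊₁`-replacement).
* J. Avigad, *Saturated models of universal theories*, APAL 118 (2002), §3.
-/

namespace Literature.Computability.MetaComplexity

open FirstOrder FirstOrder.Language FirstOrder.Language.BoundedFormula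
open Literature.ModelTheory.UniversalTheories

namespace QSym

open BASICModel

variable {k : ℕ} {K : Type} [Language.boundedArith.Structure K] [(Language.qsym k).Structure K]
  [(qsymι k).IsExpansionOn K] [hKB : K ⊨ BASIC]

/-! ## Renaming, characteristic symbols -/

section Rename

variable {n m : ℕ}

omit [Language.boundedArith.Structure K] [(qsymι k).IsExpansionOn K] hKB in
/-- **Fact (renaming).** `(relabel g e)(v) = g(v ∘ e)`. [folklore] -/
theorem app_relabel (hK : K ⊨ univTheory k) (g : QSym k n) (e : Fin n → Fin m) (v : Fin m → K) :
    app (relabel g e) v = app g (v ∘ e) := by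
  let Ψ : (Language.qsym k).BoundedFormula Empty m :=
    Term.bdEqual (qapp (relabel g e) fun i => qv i) (qapp g fun i => qv (e i))
  have hΨ : Ψ.IsUniversal := (IsAtomic.equal _ _).isQF.isUniversal
  have hfact := realize_of_fact hK hΨ (fun N _ _ _ hIk u => by
    letI := expansion N k
    simp only [Ψ, realize_bdEqual, Term.realize, funMap_expansion, Sum.elim_inr, eval_relabel]
    rfl) v
  simp only [Ψ, realize_bdEqual, Term.realize, Sum.elim_inr] at hfact
  exact hfact

/-- The characteristic symbol of a formula in context variables (meaningful for open formulas).
[folklore] -/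
def charSym (π : (Language.qsym k).BoundedFormula Empty n) : QSym k n :=
  termSym ((charTerm π).relabel (Sum.elim Empty.elim id))

/-- **Correctness of characteristic symbols**: for open `π`, `charSym π (v) = 1 ↔ π(v)` and the
value is `0` or `1`. [folklore] -/
theorem app_charSym (hK : K ⊨ univTheory k) {π : (Language.qsym k).BoundedFormula Empty n}
    (hπ : π.IsQF) (v : Fin n → K) :
    (app (charSym π) v = 1 ↔ π.Realize default v) ∧ (app (charSym π) v = 0 ∨ app (charSym π) v = 1) := by
  have h := realize_charTerm hK hπ (default : Empty → K) v
  have e : app (charSym π) v = (charTerm π).realize (Sum.elim default v) := by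
    rw [charSym, app_termSym hK, Term.realize_relabel]
    congr 1
    funext x
    rcases x with x | i
    · exact x.elim
    · rfl
  rw [e]
  exact h

end Rename

/-! ## Length induction for open formulas -/

section OpenLIND

variable {m : ℕ}

/-- **Open length induction in `K`.** For an open formula `π(p̄, j)` (context variables; the
parameters `p̄` are supplied as values): if `π(p̄, 0)` and `π(p̄, j) → π(p̄, j + 1)` for all
`j < |b|`, then `π(p̄, |b|)`.  Proof: the least `z ≤ |b|` with `χ_π(p̄, z) = 0` (a symbol of the
language, facts `lsearch_le_of_eq_zero` / `eq_zero_of_lsearch_le`) would be a nonzero `J ≤ |b|`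
with `¬π(p̄, J)` and `π(p̄, J ∸ 1)`. (Krajíček 1995, §5.3: `PV`-style theories prove open
length induction.) [cite: Krajicek1995, §5.3] -/
theorem openLIND (hK : K ⊨ univTheory k) {π : (Language.qsym k).BoundedFormula Empty (m + 1)}
    (hπ : π.IsQF) (p : Fin m → K) (b : K) (h0 : π.Realize default (Fin.snoc p 0))
    (hstep : ∀ j, j < mLen b → π.Realize default (Fin.snoc p j) → π.Realize default (Fin.snoc p (j + 1))) :
    π.Realize default (Fin.snoc p (mLen b)) := by
  -- the search symbol: arguments `(p̄, b, z)`, value `χ_π(p̄, z)`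
  let e : Fin (m + 1) → Fin (m + 2) := Fin.snoc (fun i => (Fin.castSucc i).castSucc) (Fin.last (m + 1))
  let g : QSym k (m + 2) := relabel (charSym π) e
  let s : Language.boundedArith.Term (Empty ⊕ Fin (m + 1)) := Term.var (Sum.inr (Fin.last m))
  have hs : ∀ z : K, s.realize (Sum.elim (default : Empty → K) (Fin.snoc p z)) = z := fun z => by
    simp [s]
  have hg : ∀ z w : K, app g (Fin.snoc (Fin.snoc p w) z) = app (charSym π) (Fin.snoc p z) := by
    intro z w
    rw [app_relabel hK]
    congr 1
    funext i
    cases i using Fin.lastCases with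
    | last => simp [e]
    | cast i => simp [e]
  have hχ := fun z => app_charSym hK hπ (Fin.snoc p z)
  by_contra hcon
  -- `J := lsearch g s (p̄, b)` is `≤ |b|`, not zero, `¬π(J)`, `π(J ∸ 1)`
  set J : K := app (lsearch g s) (Fin.snoc p b) with hJ
  have h0ne : (0 : K) ≠ 1 := zero_ne_one
  have hJle : J ≤ mLen b := by
    have hz : app g (Fin.snoc (Fin.snoc p b) (mLen b)) = 0 := by
      rw [hg]
      exact ((hχ _).2.resolve_right fun h1 => hcon ((hχ _).1.1 h1))
    have := lsearch_le_of_eq_zero hK g s (Fin.snoc p b) (z := mLen b) (by rw [hs]) hz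
    exact this
  have hJzero : app (charSym π) (Fin.snoc p J) = 0 := by
    rw [← hg J b]
    exact eq_zero_of_lsearch_le hK g s (Fin.snoc p b) (by rw [hs]; exact hJle)
  have hJnot : ¬ π.Realize default (Fin.snoc p J) := fun h => by
    have h1 := (hχ J).1.2 h
    rw [hJzero] at h1
    exact h0ne h1
  have hJ0 : J ≠ 0 := by
    rintro hJ0
    rw [hJ0] at hJnot
    exact hJnot h0
  -- predecessor
  obtain ⟨-, -, -, hpred⟩ := monus_spec hK (k := k) ![J, 0]
  simp only [Matrix.cons_val_zero] at hpred
  set J' : K := app (monus (k := k)) ![J, 1] with hJ'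
  have hJ'J : J' + 1 = J := hpred hJ0
  have hJ'lt : J' < J := by rw [← hJ'J]; exact lt_add_one' J'
  have hJ'b : J' < mLen b := lt_of_lt_of_le hJ'lt hJle
  -- `π(J')` by minimality of `J`
  have hπJ' : π.Realize default (Fin.snoc p J') := by
    by_contra hnot
    have hz : app g (Fin.snoc (Fin.snoc p b) J') = 0 := by
      rw [hg]
      exact ((hχ _).2.resolve_right fun h1 => hnot ((hχ _).1.1 h1))
    have hle := lsearch_le_of_eq_zero hK g s (Fin.snoc p b) (z := J') (by rw [hs]; exact hJ'b.le) hz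
    exact (not_le.2 hJ'lt) hle
  have := hstep J' hJ'b hπJ'
  rw [hJ'J] at this
  exact hJnot this

end OpenLIND

/-! ## Instantiating a formula in context variables at parameters -/

section InstCtx

variable {a : ℕ}

/-- The variable map of `instCtx`: the first `a` context variables become the parameters `p̄`,
the next two the free variables `j, u`, the last the bound variable `u'`. [folklore] -/
def instCtxMap (pa : Fin a → K) : Fin (a + 3) → (K ⊕ Fin 2) ⊕ Fin 1 :=
  Fin.snoc (Fin.snoc (Fin.snoc (fun i => Sum.inl (Sum.inl (pa i))) (Sum.inl (Sum.inr 0)))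
    (Sum.inl (Sum.inr 1))) (Sum.inr 0)

/-- **Instantiation** of a formula `Θ(p̄, j, u, u')` in context variables at parameters `p̄`:
the formula `Θ(p̄, x₀, x₁, y₀)` with free variables `x₀, x₁` and bound variable `y₀`.
[folklore] -/
def instCtx (Θ : (Language.qsym k).BoundedFormula Empty (a + 3)) (pa : Fin a → K) :
    (Language.qsym k).BoundedFormula (K ⊕ Fin 2) 1 :=
  BoundedFormula.relabel (Sum.elim Empty.elim (instCtxMap pa)) Θ.toFormula

omit [Language.boundedArith.Structure K] [(Language.qsym k).Structure K]
  [(qsymι k).IsExpansionOn K] hKB in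
/-- `instCtx` preserves openness. [folklore] -/
theorem isQF_instCtx {Θ : (Language.qsym k).BoundedFormula Empty (a + 3)} (hΘ : Θ.IsQF)
    (pa : Fin a → K) : (instCtx Θ pa).IsQF :=
  hΘ.toFormula.relabel _

omit [Language.boundedArith.Structure K] [(qsymι k).IsExpansionOn K] hKB in
/-- Semantics of `instCtx`. [folklore] -/
theorem realize_instCtx (Θ : (Language.qsym k).BoundedFormula Empty (a + 3)) (pa : Fin a → K)
    (j u u' : K) :
    (instCtx Θ pa).Realize (Sum.elim id ![j, u]) ![u'] ↔
      Θ.Realize default (Fin.snoc (Fin.snoc (Fin.snoc pa j) u) u') := by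
  rw [instCtx, realize_relabel]
  have e3 : (![u'] ∘ Fin.natAdd 1 : Fin 0 → K) = default := Subsingleton.elim _ _
  rw [e3]
  refine (realize_toFormula Θ _).trans ?_
  have e1 : ((Sum.elim (Sum.elim id ![j, u]) (![u'] ∘ Fin.castAdd 0) ∘
      Sum.elim Empty.elim (instCtxMap pa)) ∘ Sum.inl : Empty → K) = default :=
    Subsingleton.elim _ _
  have e2 : ((Sum.elim (Sum.elim id ![j, u]) (![u'] ∘ Fin.castAdd 0) ∘
      Sum.elim Empty.elim (instCtxMap pa)) ∘ Sum.inr) =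
      Fin.snoc (Fin.snoc (Fin.snoc pa j) u) u' := by
    funext i
    simp only [Function.comp_apply, Sum.elim_inr, instCtxMap]
    cases i using Fin.lastCases with
    | last => simp
    | cast i =>
      cases i using Fin.lastCases with
      | last => simp
      | cast i =>
        cases i using Fin.lastCases with
        | last => simp
        | cast i => simp
  rw [e1, e2]

omit [Language.boundedArith.Structure K] [(Language.qsym k).Structure K] [(qsymι k).IsExpansionOn K]
  hKB in
/-- `Fin.append c ![a, b] = (c, a, b)`. [folklore] -/
theorem append_two {P : Type} {q : ℕ} (c : Fin q → P) (a b : P) :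
    Fin.append c ![a, b] = Fin.snoc (Fin.snoc c a) b := by
  have e : (![a, b] : Fin 2 → P) = Fin.snoc (Fin.snoc (Fin.elim0 : Fin 0 → P) a) b := by
    funext i; fin_cases i <;> rfl
  rw [e, Fin.append_snoc, Fin.append_snoc, Fin.append_elim0]
  rfl

/-- **Skolem symbols for a step formula in context variables.** [cite: Avigad2002, Theorem 3.3] -/
theorem exists_skolem_sym_ctx (hK : K ⊨ univTheory k) (hsat : IsHerbrandSaturated (Language.qsym k) K)
    {Θ : (Language.qsym k).BoundedFormula Empty (a + 3)} (hΘ : Θ.IsQF) (pa : Fin a → K)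
    (h : ∀ j u : K, ∃ u' : K, Θ.Realize default (Fin.snoc (Fin.snoc (Fin.snoc pa j) u) u')) :
    ∃ (q : ℕ) (c : Fin q → K) (G : QSym k (q + 2)),
      ∀ j u : K, Θ.Realize default
        (Fin.snoc (Fin.snoc (Fin.snoc pa j) u) (app G (Fin.snoc (Fin.snoc c j) u))) := by
  obtain ⟨q, c, G, hG⟩ := exists_skolem_sym hK hsat (isQF_instCtx hΘ pa) fun xs => by
    obtain ⟨u', hu'⟩ := h (xs 0) (xs 1)
    refine ⟨u', ?_⟩
    have e : xs = ![xs 0, xs 1] := by funext i; fin_cases i <;> rfl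
    rw [e, realize_instCtx]
    exact hu'
  refine ⟨q, c, G, fun j u => ?_⟩
  have := hG ![j, u]
  rw [realize_instCtx, append_two] at this
  simpa using this

end InstCtx

/-! ## Iteration of a Skolem symbol -/

section Iterate

variable {a : ℕ}

/-- Extending the parameters of a symbol `G(c̄, j, u)` by two unused ones: `G'(c̄, b, R, j, u)`.
[folklore] -/
def padMap (q : ℕ) : Fin (q + 2) → Fin (q + 2 + 2) :=
  Fin.snoc (Fin.snoc (fun i => ((Fin.castSucc (Fin.castSucc i)).castSucc).castSucc)
    ((Fin.last (q + 2)).castSucc)) (Fin.last (q + 3))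

omit [Language.boundedArith.Structure K] [(Language.qsym k).Structure K] [(qsymι k).IsExpansionOn K]
  hKB in
/-- The padded argument tuple composed with `padMap` forgets the padding. [folklore] -/
theorem comp_padMap {q : ℕ} (c : Fin q → K) (b R j u : K) :
    (Fin.snoc (Fin.snoc (Fin.snoc (Fin.snoc c b) R) j) u : Fin (q + 2 + 2) → K) ∘ padMap q =
      Fin.snoc (Fin.snoc c j) u := by
  funext i
  simp only [Function.comp_apply, padMap]
  cases i using Fin.lastCases with
  | last => simp
  | cast i =>
    cases i using Fin.lastCases with
    | last => simp
    | cast i => simp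

/-- **Iteration in `K`.** Let `Θ(p̄, j, u, u')` be open and total in `u'` (`∀ j u ∃ u' Θ`) in a
Herbrand-saturated model `K` of `univTheory k`.  Then for all `u₀, b, R` there are parameters
`c̄'` and an iterate symbol `It` such that the sequence `v_j := It(c̄', u₀, j)` satisfies
`v₀ = u₀` and, for every `j < |b|`, `Θ(p̄, j, v_j, y)` for some `y` with `y ≤ R → v_{j+1} = y`
(the limited iteration, Buss 1990 Thm. 11(b), of a Skolem symbol of `Θ`).
[cite: BussContempMath1990, Thm. 11(b)] -/
theorem exists_iterate (hK : K ⊨ univTheory k) (hsat : IsHerbrandSaturated (Language.qsym k) K)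
    {Θ : (Language.qsym k).BoundedFormula Empty (a + 3)} (hΘ : Θ.IsQF) (pa : Fin a → K)
    (h : ∀ j u : K, ∃ u' : K, Θ.Realize default (Fin.snoc (Fin.snoc (Fin.snoc pa j) u) u'))
    (u₀ b R : K) :
    ∃ (q' : ℕ) (c' : Fin q' → K) (It : QSym k (q' + 2)),
      app It (Fin.snoc (Fin.snoc c' u₀) 0) = u₀ ∧
      ∀ j : K, j < mLen b → ∃ y : K,
        Θ.Realize default (Fin.snoc (Fin.snoc (Fin.snoc pa j) (app It (Fin.snoc (Fin.snoc c' u₀) j))) y) ∧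
        (y ≤ R → app It (Fin.snoc (Fin.snoc c' u₀) (j + 1)) = y) := by
  obtain ⟨q, c, G, hG⟩ := exists_skolem_sym_ctx hK hsat hΘ pa h
  -- parameters `c̄' = (c̄, b, R)`; step `G' = G` with padded arguments; `R, s` read off `c̄'`
  let c' : Fin (q + 2) → K := Fin.snoc (Fin.snoc c b) R
  let G' : QSym k (q + 2 + 2) := relabel G (padMap q)
  let Rt : Language.boundedArith.Term (Empty ⊕ Fin (q + 2)) := Term.var (Sum.inr (Fin.last (q + 1)))
  let st : Language.boundedArith.Term (Empty ⊕ Fin (q + 2)) :=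
    Term.var (Sum.inr (Fin.last q).castSucc)
  have hRt : Rt.realize (Sum.elim (default : Empty → K) c') = R := by simp [Rt, c']
  have hst : st.realize (Sum.elim (default : Empty → K) c') = b := by simp [st, c']
  have hG' : ∀ j u : K, app G' (Fin.snoc (Fin.snoc c' j) u) = app G (Fin.snoc (Fin.snoc c j) u) := by
    intro j u
    rw [app_relabel hK, comp_padMap]
  refine ⟨q + 2, c', itv G' Rt st, itv_zero hK G' Rt st (Fin.snoc c' u₀) |>.trans (by simp), ?_⟩
  intro j hj
  refine ⟨app G (Fin.snoc (Fin.snoc c j) (app (itv G' Rt st) (Fin.snoc (Fin.snoc c' u₀) j))),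
    hG j _, fun hy => ?_⟩
  have hj' : j < mLen (st.realize (Sum.elim (default : Empty → K) c')) := by rw [hst]; exact hj
  have h := itv_succ hK G' Rt st c' u₀ j hj' (by rw [hG', hRt]; exact hy)
  rw [h, hG']

/-- **Collection in `K`.** Under the hypotheses of `exists_iterate`, with start `u₀ = 0`: the
iterates are the digits of one code `W ≤ 2 S' + 1` (`S' = (2b+1) # (2R+1)`, width `|R|`),
decoded by the symbol `seqel` — a decoder which does not depend on the Skolem data.  This is
how a sharply bounded collection `∀ z ≤ |s| ∃ w ≤ r …` is witnessed by a single bounded code in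
the strict `Σᵇ` forms (the `Σᵇᵢ₊₁`-replacement step of Buss 1990, §4, Prop. 16(b), here obtained
model-theoretically in a Herbrand-saturated model). [cite: BussContempMath1990, §4, Prop. 16(b) (p. 16)] -/
theorem exists_collect (hK : K ⊨ univTheory k) (hsat : IsHerbrandSaturated (Language.qsym k) K)
    {Θ : (Language.qsym k).BoundedFormula Empty (a + 3)} (hΘ : Θ.IsQF) (pa : Fin a → K)
    (h : ∀ j u : K, ∃ u' : K, Θ.Realize default (Fin.snoc (Fin.snoc (Fin.snoc pa j) u) u'))
    (b R : K) :
    ∃ W : K, W ≤ mSmash (b + b + 1) (R + R + 1) + mSmash (b + b + 1) (R + R + 1) + 1 ∧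
      app (seqel (k := k)) ![mSmash (b + b + 1) (R + R + 1), mLen R, W, 0] = 0 ∧
      ∀ j : K, j < mLen b → ∃ y : K,
        Θ.Realize default (Fin.snoc (Fin.snoc (Fin.snoc pa j)
          (app (seqel (k := k)) ![mSmash (b + b + 1) (R + R + 1), mLen R, W, j])) y) ∧
        (y ≤ R → app (seqel (k := k)) ![mSmash (b + b + 1) (R + R + 1), mLen R, W, j + 1] = y) := by
  obtain ⟨q, c, G, hG⟩ := exists_skolem_sym_ctx hK hsat hΘ pa h
  let c' : Fin (q + 2) → K := Fin.snoc (Fin.snoc c b) R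
  let G' : QSym k (q + 2 + 2) := relabel G (padMap q)
  let Rt : Language.boundedArith.Term (Empty ⊕ Fin (q + 2)) := Term.var (Sum.inr (Fin.last (q + 1)))
  let st : Language.boundedArith.Term (Empty ⊕ Fin (q + 2)) :=
    Term.var (Sum.inr (Fin.last q).castSucc)
  have hRt : Rt.realize (Sum.elim (default : Empty → K) c') = R := by simp [Rt, c']
  have hst : st.realize (Sum.elim (default : Empty → K) c') = b := by simp [st, c']
  have hG' : ∀ j u : K, app G' (Fin.snoc (Fin.snoc c' j) u) = app G (Fin.snoc (Fin.snoc c j) u) := by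
    intro j u
    rw [app_relabel hK, comp_padMap]
  -- the code and its decoding
  let W : K := app (hist G' Rt st) (Fin.snoc c' 0)
  have hdec : ∀ j : K, app (seqel (k := k)) ![mSmash (b + b + 1) (R + R + 1), mLen R, W, j] =
      app (itv G' Rt st) (Fin.snoc (Fin.snoc c' 0) j) := by
    intro j
    have h := seqel_hist hK G' Rt st c' 0 j
    rw [hRt, hst, zero_add] at h
    exact h
  refine ⟨W, ?_, ?_, fun j hj => ?_⟩
  · have h := hist_le hK G' Rt st c' 0
    rw [hRt, hst, zero_add] at h
    exact h
  · rw [hdec]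
    exact (itv_zero hK G' Rt st (Fin.snoc c' 0)).trans (by simp)
  · refine ⟨app G (Fin.snoc (Fin.snoc c j) (app (itv G' Rt st) (Fin.snoc (Fin.snoc c' 0) j))), ?_,
      fun hy => ?_⟩
    · rw [hdec]; exact hG j _
    · have hj' : j < mLen (st.realize (Sum.elim (default : Empty → K) c')) := by rw [hst]; exact hj
      have h := itv_succ hK G' Rt st c' 0 j hj' (by rw [hG', hRt]; exact hy)
      rw [hdec, h, hG']

end Iterate

end QSym

end Literature.Computability.MetaComplexity
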